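import Literature.Probability.Percolation.RhombicTilingPlanarity
import Literature.Probability.Percolation.PlanarDuality
import Literature.Probability.Percolation.CLE6Proofs
import Literature.Topology.PlaneTopology.Brouwer
import HarnessLib

/-!
# Crossing open paths of an isoradial graph meet at a vertex

Topic `Literature/Probability/Percolation`; theorems only. The planar gluing step behind every
Russo–Seymour–Welsh / Harris–FKG chaining argument on an isoradial graph (Grimmett–Manolescu,
PTRF 159 (2014) = arXiv:1204.0505, §2.3: "In a standard application of the Harris–FKG
inequality, it suffices for the box-crossing property to consider boxes with aspect-ratio 2";
proof of Prop. 4.2 (arXiv Prop. 8): "If the event `⋂ H_k` occurs, the rectangle `S_{μ,N}` is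
crossed horizontally"; Grimmett, *Percolation* (1999), §11.7, Fig. 11.27): an open path
crossing a rectangle from left to right and an open path crossing it from bottom to top have a
*common vertex*, so that their open clusters coincide. Two ingredients:

1. **Topology** (`toCurve_inter_nonempty_of_crossing`): the polygonal curves of the two walks
   meet. After clipping each curve to the rectangle at its last exit from the entrance side and
   its first subsequent arrival at the exit side (`exists_clip_Icc`, a last-exit/first-entry
   argument for a continuous real function), this is Maehara's crossing lemma
   `Literature.Topology.PlaneTopology.exists_mem_of_crossing` (Brouwer's fixed point theorem).
   No planarity is needed for this step; the drawing `f : V → ℂ` is arbitrary.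
2. **Planarity** (`exists_mem_support_of_toCurve_inter_nonempty`): in an isoradial rhombic
   tiling (`IsIsoradial`, `IsRhombicTiling`) two walks of `G` whose polygonal curves meet share a
   vertex — the closed straight edges of distinct edges meet only at common endpoints
   (`segment_z_inter_segment_z_subset`, file `RhombicTilingPlanarity`).

Combined: `exists_mem_support_inter_of_crossing` (walk level) and, for the percolation events,
`exists_common_vertex_of_openCrossing` (two `openCrossing` events of a configuration
`ω ⊆ E(G)` whose constraint sets are a horizontal and a vertical strip crossing each other are
realised by open paths through a common vertex `v`, which is therefore joined inside the
respective sets to all four sides).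

## References

* G. R. Grimmett, I. Manolescu, *Bond percolation on isoradial graphs: criticality and
  universality*, PTRF 159 (2014) 273–327, arXiv:1204.0505, §2.3 and proof of Prop. 4.2.
* G. Grimmett, *Percolation*, 2nd ed., Springer (1999), §11.7 (RSW chaining, Fig. 11.27).
* R. Maehara, *The Jordan curve theorem via the Brouwer fixed point theorem*, Amer. Math.
  Monthly 91 (1984), Lemma (the crossing lemma).
-/

noncomputable section

namespace Literature.Probability.Percolation

open Complex Metric Set
open Literature.Probability.LatticeModels Literature.Topology.PlaneTopology

/-! ### Clipping a continuous real function to an interval of values -/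

/-- **Last exit, first entry.** Let `g` be continuous on `[0, 1]` with `g 0 ≤ a₁ ≤ a₂ ≤ g 1`.
Then there are `0 ≤ s₀ ≤ s₁ ≤ 1` with `g s₀ = a₁`, `g s₁ = a₂` and `g [s₀, s₁] ⊆ [a₁, a₂]`:
`s₀` is the last time with `g ≤ a₁` and `s₁` the first time after `s₀` with `a₂ ≤ g`
(compactness of the two closed sets of times, and the intermediate value theorem). [folklore] -/
theorem exists_clip_Icc {g : ℝ → ℝ} (hg : ContinuousOn g (Icc 0 1)) {a₁ a₂ : ℝ} (h12 : a₁ ≤ a₂)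
    (h0 : g 0 ≤ a₁) (h1 : a₂ ≤ g 1) :
    ∃ s₀ s₁ : ℝ, 0 ≤ s₀ ∧ s₀ ≤ s₁ ∧ s₁ ≤ 1 ∧ g s₀ = a₁ ∧ g s₁ = a₂ ∧
      ∀ s ∈ Icc s₀ s₁, g s ∈ Icc a₁ a₂ := by
  -- last time with `g ≤ a₁`
  set T₀ : Set ℝ := Icc 0 1 ∩ g ⁻¹' Iic a₁ with hT₀
  have hT₀c : IsCompact T₀ :=
    (isCompact_Icc.inter_right (hg.preimage_isClosed_of_isClosed isClosed_Icc isClosed_Iic) :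
      IsCompact (Icc 0 1 ∩ (Icc 0 1 ∩ g ⁻¹' Iic a₁))).of_isClosed_subset
      ((hg.preimage_isClosed_of_isClosed isClosed_Icc isClosed_Iic)) (fun s hs => ⟨hs.1, hs⟩)
  have h0T : (0 : ℝ) ∈ T₀ := ⟨⟨le_rfl, zero_le_one⟩, h0⟩
  set s₀ : ℝ := sSup T₀ with hs₀
  have hs₀T : s₀ ∈ T₀ := hT₀c.sSup_mem ⟨0, h0T⟩
  have hs₀le : ∀ s ∈ T₀, s ≤ s₀ := fun s hs => le_csSup hT₀c.bddAbove hs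
  obtain ⟨⟨hs₀0, hs₀1⟩, hgs₀⟩ := hs₀T
  have hafter : ∀ s, s₀ < s → s ≤ 1 → a₁ < g s := by
    intro s hs hs1
    by_contra hle
    push Not at hle
    have : s ∈ T₀ := ⟨⟨hs₀0.trans hs.le, hs1⟩, hle⟩
    exact absurd (hs₀le s this) (not_le.2 hs)
  -- first time after `s₀` with `a₂ ≤ g`
  set T₁ : Set ℝ := Icc s₀ 1 ∩ g ⁻¹' Ici a₂ with hT₁
  have hg' : ContinuousOn g (Icc s₀ 1) := hg.mono (Icc_subset_Icc_left hs₀0)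
  have hT₁c : IsCompact T₁ :=
    (isCompact_Icc.inter_right (hg'.preimage_isClosed_of_isClosed isClosed_Icc isClosed_Ici) :
      IsCompact (Icc s₀ 1 ∩ (Icc s₀ 1 ∩ g ⁻¹' Ici a₂))).of_isClosed_subset
      ((hg'.preimage_isClosed_of_isClosed isClosed_Icc isClosed_Ici)) (fun s hs => ⟨hs.1, hs⟩)
  have h1T : (1 : ℝ) ∈ T₁ := ⟨⟨hs₀1, le_rfl⟩, h1⟩
  set s₁ : ℝ := sInf T₁ with hs₁
  have hs₁T : s₁ ∈ T₁ := hT₁c.sInf_mem ⟨1, h1T⟩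
  have hs₁le : ∀ s ∈ T₁, s₁ ≤ s := fun s hs => csInf_le hT₁c.bddBelow hs
  obtain ⟨⟨hs₀s₁, hs₁1⟩, hgs₁⟩ := hs₁T
  have hbefore : ∀ s, s₀ ≤ s → s < s₁ → g s < a₂ := by
    intro s hs hs'
    by_contra hle
    push Not at hle
    have : s ∈ T₁ := ⟨⟨hs, hs'.le.trans hs₁1⟩, hle⟩
    exact absurd (hs₁le s this) (not_le.2 hs')
  -- the values at the two ends, by the intermediate value theorem on `[s₀, s₁]`
  have hgI : ContinuousOn g (Icc s₀ s₁) := hg.mono (Icc_subset_Icc hs₀0 hs₁1)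
  have hIVT := intermediate_value_Icc hs₀s₁ hgI
  have hgs₀eq : g s₀ = a₁ := by
    obtain ⟨s, ⟨hs, hs'⟩, hseq⟩ := hIVT ⟨hgs₀, h12.trans hgs₁⟩
    have hsT : s ∈ T₀ := ⟨⟨hs₀0.trans hs, hs'.trans hs₁1⟩, hseq.le⟩
    have : s = s₀ := le_antisymm (hs₀le s hsT) hs
    rw [← this, hseq]
  have hgs₁eq : g s₁ = a₂ := by
    obtain ⟨s, ⟨hs, hs'⟩, hseq⟩ := hIVT ⟨hgs₀.trans h12, hgs₁⟩
    have hsT : s ∈ T₁ := ⟨⟨hs, hs'.trans hs₁1⟩, hseq.ge⟩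
    have : s = s₁ := le_antisymm hs' (hs₁le s hsT)
    rw [← this, hseq]
  refine ⟨s₀, s₁, hs₀0, hs₀s₁, hs₁1, hgs₀eq, hgs₁eq, fun s hs => ?_⟩
  obtain ⟨hs, hs'⟩ := hs
  constructor
  · rcases hs.eq_or_lt with rfl | hlt
    · exact hgs₀eq.ge
    · exact (hafter s hlt (hs'.trans hs₁1)).le
  · rcases hs'.eq_or_lt with rfl | hlt
    · exact hgs₁eq.le
    · exact (hbefore s hs hlt).le

/-! ### The polygonal curves of crossing walks meet -/

section Curves

variable {V : Type*} {G : SimpleGraph V}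

/-- The trace of the curve of a non-trivial walk is covered by the closed segments of its darts.
[folklore] -/
theorem range_toCurve_subset_iUnion (f : V → ℂ) {x y : V} {p : G.Walk x y} (hp : ¬ p.Nil) :
    Set.range (p.toCurve f) ⊆ ⋃ d ∈ p.darts, segment ℝ (f d.fst) (f d.snd) :=
  SimpleGraph.Walk.range_toCurve_subset_of_not_nil hp fun d hd =>
    Set.subset_iUnion₂ (s := fun (e : G.Dart) (_ : e ∈ p.darts) => segment ℝ (f e.fst) (f e.snd)) d hd

/-- The trace of the curve of a walk lies in any convex set containing its vertices. [folklore] -/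
theorem range_toCurve_subset_of_convex (f : V → ℂ) {x y : V} (p : G.Walk x y) {C : Set ℂ}
    (hC : Convex ℝ C) (hp : ∀ v ∈ p.support, f v ∈ C) : Set.range (p.toCurve f) ⊆ C :=
  SimpleGraph.Walk.range_toCurve_subset p (hp x p.start_mem_support) fun _ hd =>
    hC.segment_subset (hp _ (p.dart_fst_mem_support_of_mem_darts hd))
      (hp _ (p.dart_snd_mem_support_of_mem_darts hd))

/-- The curve of a walk ends at its (drawn) final vertex. [folklore] -/
theorem toCurve_one (f : V → ℂ) {x y : V} (p : G.Walk x y) : p.toCurve f 1 = f y := by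
  cases p with
  | nil => simp [SimpleGraph.Walk.toCurve, polyline]
  | cons h q => simp [SimpleGraph.Walk.toCurve, polyline_apply_one, List.getLast_map]

/-- **Crossing curves meet** (Maehara's crossing lemma applied to clipped polygonal curves). Let
`p` be a walk drawn (by an arbitrary `f : V → ℂ`) inside the horizontal strip
`{c₁ ≤ im ≤ c₂}` from `{re ≤ a₁}` to `{a₂ ≤ re}`, and `q` a walk drawn inside the vertical strip
`{a₁ ≤ re ≤ a₂}` from `{im ≤ c₁}` to `{c₂ ≤ im}`, with `a₁ ≤ a₂`, `c₁ ≤ c₂`. Then the two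
polygonal curves have a common point. (Grimmett 1999, §11.7; GM 2014, §2.3.)
[cite: Maehara1984, Lemma] -/
theorem toCurve_inter_nonempty_of_crossing (f : V → ℂ) {H₁ H₂ : SimpleGraph V} {x y x' y' : V}
    (p : H₁.Walk x y) (q : H₂.Walk x' y') {a₁ a₂ c₁ c₂ : ℝ} (ha : a₁ ≤ a₂) (hc : c₁ ≤ c₂)
    (hp : ∀ v ∈ p.support, (f v).im ∈ Icc c₁ c₂) (hx : (f x).re ≤ a₁) (hy : a₂ ≤ (f y).re)
    (hq : ∀ v ∈ q.support, (f v).re ∈ Icc a₁ a₂) (hx' : (f x').im ≤ c₁) (hy' : c₂ ≤ (f y').im) :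
    (Set.range (p.toCurve f) ∩ Set.range (q.toCurve f)).Nonempty := by
  -- the two curves as functions on `ℝ`
  set P : ℝ → ℂ := fun s => p.toCurve f (Set.projIcc 0 1 zero_le_one s) with hP
  set Q : ℝ → ℂ := fun s => q.toCurve f (Set.projIcc 0 1 zero_le_one s) with hQ
  have hPc : Continuous P := (p.toCurve f).continuous.comp continuous_projIcc
  have hQc : Continuous Q := (q.toCurve f).continuous.comp continuous_projIcc
  have hP0 : P 0 = f x := by simp [hP, Set.projIcc_left]
  have hP1 : P 1 = f y := by
    simp only [hP, Set.projIcc_right]; exact toCurve_one f p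
  have hQ0 : Q 0 = f x' := by simp [hQ, Set.projIcc_left]
  have hQ1 : Q 1 = f y' := by
    simp only [hQ, Set.projIcc_right]; exact toCurve_one f q
  have hPstrip : ∀ s, (P s).im ∈ Icc c₁ c₂ := by
    intro s
    have hconv : Convex ℝ {w : ℂ | w.im ∈ Icc c₁ c₂} := (convex_Icc c₁ c₂).linear_preimage imLm
    exact range_toCurve_subset_of_convex f p hconv hp ⟨_, rfl⟩
  have hQstrip : ∀ s, (Q s).re ∈ Icc a₁ a₂ := by
    intro s
    have hconv : Convex ℝ {w : ℂ | w.re ∈ Icc a₁ a₂} := (convex_Icc a₁ a₂).linear_preimage reLm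
    exact range_toCurve_subset_of_convex f q hconv hq ⟨_, rfl⟩
  -- clip `re ∘ P` to `[a₁, a₂]` and `im ∘ Q` to `[c₁, c₂]`
  obtain ⟨s₀, s₁, hs₀, hs₀₁, hs₁, hgs₀, hgs₁, hPclip⟩ :=
    exists_clip_Icc (g := fun s => (P s).re) (continuous_re.comp hPc).continuousOn ha
      (by simpa [hP0] using hx) (by simpa [hP1] using hy)
  obtain ⟨t₀, t₁, ht₀, ht₀₁, ht₁, hgt₀, hgt₁, hQclip⟩ :=
    exists_clip_Icc (g := fun s => (Q s).im) (continuous_im.comp hQc).continuousOn hc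
      (by simpa [hQ0] using hx') (by simpa [hQ1] using hy')
  -- reparametrise the clipped pieces by `[0, 1]`
  set γ : ℝ → ℂ := fun u => P (s₀ + u * (s₁ - s₀)) with hγ
  set β : ℝ → ℂ := fun u => Q (t₀ + u * (t₁ - t₀)) with hβ
  have hγc : Continuous γ := hPc.comp (continuous_const.add (continuous_id.mul continuous_const))
  have hβc : Continuous β := hQc.comp (continuous_const.add (continuous_id.mul continuous_const))
  have hmemI : ∀ {u lo hi : ℝ}, lo ≤ hi → u ∈ Icc (0 : ℝ) 1 → lo + u * (hi - lo) ∈ Icc lo hi := by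
    intro u lo hi hlh hu
    obtain ⟨hu0, hu1⟩ := hu
    constructor <;> nlinarith
  have hγK : MapsTo γ (Icc 0 1) (Icc a₁ a₂ ×ℂ Icc c₁ c₂) := by
    intro u hu
    rw [mem_reProdIm]
    exact ⟨hPclip _ (hmemI hs₀₁ hu), hPstrip _⟩
  have hβK : MapsTo β (Icc 0 1) (Icc a₁ a₂ ×ℂ Icc c₁ c₂) := by
    intro u hu
    rw [mem_reProdIm]
    exact ⟨hQstrip _, hQclip _ (hmemI ht₀₁ hu)⟩
  have hγ0 : (γ 0).re = a₁ := by simp [hγ, hgs₀]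
  have hγ1 : (γ 1).re = a₂ := by simp [hγ, hgs₁]
  have hβ0 : (β 0).im = c₁ := by simp [hβ, hgt₀]
  have hβ1 : (β 1).im = c₂ := by simp [hβ, hgt₁]
  obtain ⟨s, -, t, -, hst⟩ :=
    exists_mem_of_crossing hβc.continuousOn hγc.continuousOn hβK hγK hβ0 hβ1 hγ0 hγ1
  refine ⟨β t, ?_, ?_⟩
  · rw [hst]; exact ⟨_, rfl⟩
  · exact ⟨_, rfl⟩

end Curves

/-! ### In a rhombic tiling, crossing walks share a vertex -/

section Tiling

variable {V F : Type*} {G : SimpleGraph V} {emb : RhombicEmbedding G F}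

/-- The open graph of a lattice configuration is a subgraph of the lattice. [folklore] -/
theorem openGraph_le_of_subset {ω : BondConfig V} (hω : ω ⊆ G.edgeSet) : openGraph ω ≤ G :=
  fun _ _ h => hω ((openGraph_adj ω _ _).1 h).1

/-- **Planarity step.** In an isoradial rhombic tiling, two non-trivial walks in subgraphs of `G`
whose polygonal curves (vertices drawn by `emb.z`, straight edges) have a common point share a
vertex: the common point lies on a closed edge of each walk, and distinct closed edges of `G`
meet only at a common endpoint (`segment_z_inter_segment_z_subset`). (Grimmett–Manolescu 2014,
§4.1: `G` is a plane graph.) [cite: GrimmettManolescu2014Isoradial, §4.1 (diamond graph and rhombic tiling)] -/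
theorem exists_mem_support_of_toCurve_inter_nonempty (hiso : emb.IsIsoradial)
    (hrh : emb.IsRhombicTiling) {H₁ H₂ : SimpleGraph V} (h₁ : H₁ ≤ G) (h₂ : H₂ ≤ G)
    {x y x' y' : V} {p : H₁.Walk x y} {q : H₂.Walk x' y'} (hp : ¬ p.Nil) (hq : ¬ q.Nil)
    (h : (Set.range (p.toCurve emb.z) ∩ Set.range (q.toCurve emb.z)).Nonempty) :
    ∃ v ∈ p.support, v ∈ q.support := by
  obtain ⟨X, hXp, hXq⟩ := h
  obtain ⟨d₁, hd₁, hX₁⟩ := Set.mem_iUnion₂.1 (range_toCurve_subset_iUnion emb.z hp hXp)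
  obtain ⟨d₂, hd₂, hX₂⟩ := Set.mem_iUnion₂.1 (range_toCurve_subset_iUnion emb.z hq hXq)
  have h1f := p.dart_fst_mem_support_of_mem_darts hd₁
  have h1s := p.dart_snd_mem_support_of_mem_darts hd₁
  have h2f := q.dart_fst_mem_support_of_mem_darts hd₂
  have h2s := q.dart_snd_mem_support_of_mem_darts hd₂
  by_cases he : (⟨d₁.toProd, h₁ d₁.adj⟩ : G.Dart).edge = (⟨d₂.toProd, h₂ d₂.adj⟩ : G.Dart).edge
  · -- same edge: the endpoints agree up to order
    rw [SimpleGraph.Dart.edge, SimpleGraph.Dart.edge, Sym2.eq_iff] at he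
    rcases he with ⟨h, -⟩ | ⟨h, -⟩
    · exact ⟨d₁.fst, h1f, h ▸ h2f⟩
    · exact ⟨d₁.fst, h1f, h ▸ h2s⟩
  · have hmem := segment_z_inter_segment_z_subset hiso hrh he ⟨hX₁, hX₂⟩
    simp only [mem_inter_iff, mem_insert_iff, mem_singleton_iff] at hmem
    obtain ⟨hA, hB⟩ := hmem
    rcases hA with hA | hA <;> rcases hB with hB | hB
    · exact ⟨d₁.fst, h1f, hiso.z_injective (hA.symm.trans hB) ▸ h2f⟩
    · exact ⟨d₁.fst, h1f, hiso.z_injective (hA.symm.trans hB) ▸ h2s⟩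
    · exact ⟨d₁.snd, h1s, hiso.z_injective (hA.symm.trans hB) ▸ h2f⟩
    · exact ⟨d₁.snd, h1s, hiso.z_injective (hA.symm.trans hB) ▸ h2s⟩

/-- **Crossing walks of an isoradial graph share a vertex.** Let `p` be a walk in a subgraph of
`G` drawn in the horizontal strip `{c₁ ≤ im ≤ c₂}` from `{re ≤ a₁}` to `{a₂ ≤ re}` and `q` a
walk in a subgraph of `G` drawn in the vertical strip `{a₁ ≤ re ≤ a₂}` from `{im ≤ c₁}` to
`{c₂ ≤ im}`, with `a₁ < a₂` and `c₁ < c₂` (vertices drawn by `emb.z`, an isoradial rhombic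
tiling). Then `p` and `q` have a common vertex. (Grimmett–Manolescu 2014, §2.3 and proof of
Prop. 4.2; Grimmett 1999, §11.7.)
[cite: GrimmettManolescu2014Isoradial, §2.3 (Harris–FKG reduction) and proof of Prop. 4.2] -/
theorem exists_mem_support_inter_of_crossing (hiso : emb.IsIsoradial) (hrh : emb.IsRhombicTiling)
    {H₁ H₂ : SimpleGraph V} (h₁ : H₁ ≤ G) (h₂ : H₂ ≤ G) {x y x' y' : V} (p : H₁.Walk x y)
    (q : H₂.Walk x' y') {a₁ a₂ c₁ c₂ : ℝ} (ha : a₁ < a₂) (hc : c₁ < c₂)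
    (hp : ∀ v ∈ p.support, (emb.z v).im ∈ Icc c₁ c₂) (hx : (emb.z x).re ≤ a₁)
    (hy : a₂ ≤ (emb.z y).re) (hq : ∀ v ∈ q.support, (emb.z v).re ∈ Icc a₁ a₂)
    (hx' : (emb.z x').im ≤ c₁) (hy' : c₂ ≤ (emb.z y').im) :
    ∃ v ∈ p.support, v ∈ q.support := by
  have hpN : ¬ p.Nil := by
    rintro ⟨⟩
    linarith
  have hqN : ¬ q.Nil := by
    rintro ⟨⟩
    linarith
  exact exists_mem_support_of_toCurve_inter_nonempty hiso hrh h₁ h₂ hpN hqN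
    (toCurve_inter_nonempty_of_crossing emb.z p q ha.le hc.le hp hx hy hq hx' hy')

/-- **Event form.** For a configuration `ω ⊆ E(G)` on an isoradial rhombic tiling, suppose
`ω ∈ openCrossing S A B` with `S` drawn in the horizontal strip `{c₁ ≤ im ≤ c₂}`, `A` in
`{re ≤ a₁}`, `B` in `{a₂ ≤ re}`, and `ω ∈ openCrossing S' A' B'` with `S'` in the vertical strip
`{a₁ ≤ re ≤ a₂}`, `A'` in `{im ≤ c₁}`, `B'` in `{c₂ ≤ im}` (`a₁ < a₂`, `c₁ < c₂`). Then some
vertex `v ∈ S ∩ S'` is joined by open paths inside `S` to `A` and to `B`, and inside `S'` to `A'`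
and to `B'` — the two crossing clusters are one. This is the gluing step of the Harris–FKG
chaining of box crossings (Grimmett–Manolescu 2014, §2.3; proof of Prop. 4.2, events `H_k`;
Grimmett 1999, §11.7). The hypothesis `ω ⊆ E(G)` is almost sure under `P_G`.
[cite: GrimmettManolescu2014Isoradial, §2.3 (Harris–FKG reduction) and proof of Prop. 4.2] -/
theorem exists_common_vertex_of_openCrossing (hiso : emb.IsIsoradial)
    (hrh : emb.IsRhombicTiling) {ω : BondConfig V} (hω : ω ⊆ G.edgeSet)
    {S A B S' A' B' : Set V} {a₁ a₂ c₁ c₂ : ℝ} (ha : a₁ < a₂) (hc : c₁ < c₂)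
    (hS : ∀ v ∈ S, (emb.z v).im ∈ Icc c₁ c₂) (hA : ∀ v ∈ A, (emb.z v).re ≤ a₁)
    (hB : ∀ v ∈ B, a₂ ≤ (emb.z v).re) (hS' : ∀ v ∈ S', (emb.z v).re ∈ Icc a₁ a₂)
    (hA' : ∀ v ∈ A', (emb.z v).im ≤ c₁) (hB' : ∀ v ∈ B', c₂ ≤ (emb.z v).im)
    (h₁ : ω ∈ openCrossing S A B) (h₂ : ω ∈ openCrossing S' A' B') :
    ∃ v, v ∈ S ∧ v ∈ S' ∧ (∃ x ∈ A, ω ∈ openConnIn S x v) ∧ (∃ y ∈ B, ω ∈ openConnIn S v y) ∧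
      (∃ x' ∈ A', ω ∈ openConnIn S' x' v) ∧ (∃ y' ∈ B', ω ∈ openConnIn S' v y') := by
  classical
  obtain ⟨x, hx, y, hy, hxy⟩ := h₁
  obtain ⟨x', hx', y', hy', hxy'⟩ := h₂
  obtain ⟨p, hpS, hpω⟩ := exists_walk_of_mem_openConnIn hω hxy
  obtain ⟨q, hqS, hqω⟩ := exists_walk_of_mem_openConnIn hω hxy'
  obtain ⟨v, hvp, hvq⟩ := exists_mem_support_inter_of_crossing hiso hrh le_rfl le_rfl p q ha hc
    (fun v hv => hS v (hpS v hv)) (hA x hx) (hB y hy) (fun v hv => hS' v (hqS v hv)) (hA' x' hx')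
    (hB' y' hy')
  refine ⟨v, hpS v hvp, hqS v hvq, ⟨x, hx, ?_⟩, ⟨y, hy, ?_⟩, ⟨x', hx', ?_⟩, ⟨y', hy', ?_⟩⟩
  · exact mem_openConnIn_of_walk (p.takeUntil v hvp)
      (fun z hz => hpS z (p.support_takeUntil_subset_support hvp hz))
      (fun e he => hpω e (p.edges_takeUntil_subset_edges hvp he))
  · exact mem_openConnIn_of_walk (p.dropUntil v hvp)
      (fun z hz => hpS z (p.support_dropUntil_subset_support hvp hz))
      (fun e he => hpω e (p.edges_dropUntil_subset_edges hvp he))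
  · exact mem_openConnIn_of_walk (q.takeUntil v hvq)
      (fun z hz => hqS z (q.support_takeUntil_subset_support hvq hz))
      (fun e he => hqω e (q.edges_takeUntil_subset_edges hvq he))
  · exact mem_openConnIn_of_walk (q.dropUntil v hvq)
      (fun z hz => hqS z (q.support_dropUntil_subset_support hvq hz))
      (fun e he => hqω e (q.edges_dropUntil_subset_edges hvq he))

end Tiling

end Literature.Probability.Percolation

end
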